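import Summits.HodgeConjecture.HodgeConjecture.Theorems.Ring2HypothesesDescentAbsoluteSurjections
import Summits.HodgeConjecture.CorCM.Stage4StrictRoadDischargePowers
import Literature.AlgebraicGeometry.Motives.AbelianVarietyQuotientOfJacobianHolds
import HarnessLib

/-!
# Ring 2 — hypotheses layer, descent axis: ONE EXPONENT PER CURVE — row b06 ⟺ Charles–Schnell's 11.2.18 at the single
# `(2g+2)`-fold `(C × C)^{g+1}` of every smooth projective complex curve `C`; `HC_AV` ⟺ the Hodge conjecture at
# `(C × C)^{g+1}` for every curve (hypothesis-free)

HONEST FRAMING (page 1, verbatim the cell's standing line): **research route conditional on HC_CM; not a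
corollary; Q11.4-sentence-2 already refuted in dim ≥ 3.** Nothing in this file proves a case of the Hodge conjecture;
nothing discharges the binder of record b06 `Ring2.Hypotheses.AbsoluteHodgeImpliesAlgebraicAV` (`Ring2HypothesesDescent.lean`
:73; OPEN); the binder table's numbers do not move; `HC_CM` (`Theses.RankFourFaces.CMAbelianHodge`) does not occur in
this file. Row b06 occurs only inside `↔` or as the displayed hypothesis `h`; `HC_AV`
(`Theses.PadicSemiregularLift.HodgeAbelianVarieties`) only inside `↔` / `¬ … ↔` or as the displayed hypothesis `hAV`;
neither is asserted.

Hodge ladder STAGE 3, `BINDER-OWNERS.md` row **b06**, seat `ring2-b06` (gen 77), fourth file; consequence of the companion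
`Ring2HypothesesDescentAbsoluteSurjections` (same gen: 11.2.18 and the Hodge conjecture descend along surjective morphisms
of ANY relative dimension, no powers). gens 75–76 recorded as NOT obtained «a genus / exponent bound» for their curve-power
forms `HC_AV ⟺ ∀ C ∀ N, HC(Cᴺ)` (p283528 `hc_av_iff_curvePow`) and `row b06 ⟺ ∀ C ∀ k, 11.2.18(Cᵏ)` (p298179
`absoluteHodgeImpliesAlgebraicAV_iff_curvePow_of_facts`). Serre's signed sum map `s_g : (C × C)^{g+1} → J(C)` of the
Albanese map of a point (`g = dim J(C)`; the tree's `Motives.pmSum`, surjective by `Generates.surjective_pmSum_of_dim_le`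
with `Jacobian.generates_abelJacobi` — Serre 1958 no. 2, Milne JV proof of Prop. 6.1) and the quotient `J(C) ↠ A` of
Lange–Birkenhake Prop. 4.5.8 (the tree's THEOREM `langeBirkenhake1992_exists_jacobian_surjective_hom_holds`) are
surjective morphisms of smooth projective varieties, so the companion's descents give:

* `absoluteHodgeClassesAreAlgebraicFor_jacobian_of_pmPow`, `absoluteHodgeImpliesAlgebraicAV_of_forall_pmPow` — 11.2.18 at
  `(C × C)^{g+1}` ⟹ 11.2.18 at `J(C)`; for all curves ⟹ ROW b06 (mod (N)+(E) + V-B3 + T1c + CS7 + CS8);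
* `absoluteHodgeClassesAreAlgebraicFor_pmPow_of_absoluteHodgeImpliesAlgebraicAV` — the converse (gen 76's domination
  form: `(C × C)^{g+1}` is dominated by the powers of `J(C)`);
* **`absoluteHodgeImpliesAlgebraicAV_iff_forall_pmPow` — ROW b06 ⟺ ∀ smooth projective complex curves `C` (any Jacobian
  `𝒥`, `g = dim J`), 11.2.18 at the SINGLE variety `(C × C)^{g+1}` of dimension `2g + 2`** (mod the six facts);
* **`hc_av_iff_forall_pmPow` — `HC_AV ⟺` the Hodge conjecture for the `(2g+2)`-fold `(C × C)^{g+1}` of every smooth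
  projective complex curve — HYPOTHESIS-FREE** (`⟹` is the Stage-4 kernel theorem
  `hc_of_isDominatedByPowers_abelianVariety_holds`, Arapura Lemma 4.2 PROVED; `⟸` the companion's
  `hodgeConjectureFor_of_surjective` twice); `not_hc_av_iff_exists_pmPow`.

The exponent `2g + 2` is Serre's bound `n ≥ dim A` for the surjectivity of the signed sum maps; no Jacobi inversion
(`C^{(g)} ↠ J`) is used or available on the tree's cartesian powers.

HONEST COLUMN. Nothing is discharged; «10 · 0» unchanged; the six facts displayed only; the `HC_AV` statements use NO
named fact; no definition, no new named fact, no sorry. NOT obtained: the exponent `g` itself; a bound uniform in the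
abelian variety rather than per curve; anything about `HC_CM`.

PRESEARCH: as in the companion, plus «Hodge conjecture for abelian varieties equivalent to products / symmetric powers
of curves» → [corpus: paper:arxiv-math_0501348 Arapura §1 Lemma 1.3 «the map `Xⁿ → Alb(X)` … is surjective for some
`n`»]; vsearch / galaxy all stars «self-product of a curve|Jacobian|Hodge conjecture»: Schoen 1988 (`C⁸ ↠ B` Prym
transfer, the tree's `SurjectivePullbackAlgebraicClasses` source) — equidimensional; no single-exponent equivalence in
print found. Certification by assembly (Serre no. 2 + Lange–Birkenhake 4.5.8 + the companion's lift); no novelty in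
print claimed beyond the kernel assembly.

References (bib keys): Serre1958MorphismesUniversels (no. 1 Déf. 1, no. 2 Thm. 1–2), Milne1986JacobianVarieties (§6
Prop. 6.1, §10 Thm. 10.1), LangeBirkenhake1992 (Prop. 4.5.8), Arapura2006 (§1 Lemma 1.1, Cor. 1.2, Lemma 1.3; §4 Lemma
4.2), CharlesSchnell2014Notes (§11.2.5 statements 11.2.17–11.2.18), Schoen1988HodgeWeil (§3), vanGeemen1994HodgeAV
(§3.7 Lemma 3.7), Deligne1982HodgeCycles (Main Thm. 2.11).
-/

noncomputable section

set_option linter.dupNamespace false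

open CategoryTheory AlgebraicGeometry MonoidalCategory CartesianMonoidalCategory
open Literature.AlgebraicTopology.SingularHomology Literature.Geometry.Kaehler
open Literature.AlgebraicGeometry Literature.AlgebraicGeometry.Motives
open Literature.AlgebraicGeometry.Motives.AbelianVariety
open Literature.AlgebraicGeometry.HodgeTheory
open Summit.HodgeConjecture.HodgeConjecture.Theorems
open Summit.HodgeConjecture.CorCM.Stage4 (isDominatedByPowers_trans isDominatedByPowers_curve_jacobian
  hc_of_isDominatedByPowers_abelianVariety_holds)
open Summit.HodgeConjecture.HodgeConjecture.Theses.PadicSemiregularLift (HodgeAbelianVarieties)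

namespace Summit.HodgeConjecture.HodgeConjecture.Ring2.Hypotheses

/-! ## §4 One exponent per curve: `(C × C)^{g+1} ↠ J(C) ↠ A` -/

section OneExponent

variable {C : SchemeOver ℂ}

/-- **11.2.18 at the `(2g+2)`-fold `(C × C)^{g+1}` gives 11.2.18 at the Jacobian `J(C)`** (`g = dim J(C)`; Serre's signed
sum map `s_g : (C × C)^{g+1} → J(C)` of the Albanese map of a point is a SURJECTIVE morphism — `Jacobian.generates_abelJacobi`
with `Generates.surjective_pmSum_of_dim_le`, Serre 1958 no. 2 — and §3), mod the six facts. The source `Motives.pmPow C g`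
is smooth projective of dimension `(g + 1) · (1 + 1)` (gen 75's `isSmoothProjective_pmPow`).
[cite: Serre1958MorphismesUniversels, no. 1 Déf. 1 and no. 2 Thm. 1] [cite: Milne1986JacobianVarieties, §6 Prop. 6.1 (proof)]
[cite: CharlesSchnell2014Notes, §11.2.5 statement 11.2.18] -/
theorem absoluteHodgeClassesAreAlgebraicFor_jacobian_of_pmPow (hN : chartConjugation_canonical)
    (hex : ∀ ⦃n : ℕ⦄ ⦃X : SchemeOver ℂ⦄, IsSmoothProjective n X →
      ∀ (σ : ℂ ≃+* ℂ) (p : ℕ) (c : complexBetti X (2 * p)), ∃ s, IsConjugateClass σ X (2 * p) c s)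
    (hZf : deligne1982_cycleClass_absoluteHodge) (hL : deligne1982_lefschetz_absoluteHodge_iff)
    (hcup : deligne1982_cupProduct_absoluteHodge) (hgys : deligne1982_gysinFst_absoluteHodge)
    (hC : IsSmoothProjective 1 C) (𝒥 : Jacobian C)
    (h : AbsoluteHodgeClassesAreAlgebraicFor ((𝒥.J.dim + 1) * (1 + 1)) (pmPow C 𝒥.J.dim)) :
    AbsoluteHodgeClassesAreAlgebraicFor 𝒥.J.dim 𝒥.J.X := by
  haveI : IsProper C.hom := IsSmoothProjective.isProper_holds hC
  haveI : GeometricallyIntegral C.hom := IsSmoothProjective.geometricallyIntegral_holds hC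
  obtain ⟨P⟩ := hC.nonempty_algPoints ℂ
  haveI : Surjective (pmSum (𝒥.abelJacobi P) 𝒥.J.dim).left :=
    (Jacobian.generates_abelJacobi 𝒥 P).surjective_pmSum_of_dim_le P.toUnitHom le_rfl
  exact absoluteHodgeClassesAreAlgebraicFor_of_surjective hN hex hZf hL hcup hgys (isSmoothProjective_pmPow hC 𝒥.J.dim)
    AbelianVariety.isSmoothProjective_holds (pmSum (𝒥.abelJacobi P) 𝒥.J.dim) h

/-- **11.2.18 at the `(C × C)^{g+1}` of every curve gives ROW b06** (mod the six facts): every complex abelian variety `A`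
is a quotient `J(C) ↠ A` of a Jacobian (Lange–Birkenhake Prop. 4.5.8 = Milne JV Thm. 10.1, the tree's theorem
`langeBirkenhake1992_exists_jacobian_surjective_hom_holds`), and 11.2.18 descends along `(C × C)^{g+1} ↠ J(C) ↠ A` (§3).
[cite: LangeBirkenhake1992, Prop. 4.5.8] [cite: Milne1986JacobianVarieties, §10 Thm. 10.1 (p. 198)]
[cite: CharlesSchnell2014Notes, §11.2.5 statement 11.2.18] -/
theorem absoluteHodgeImpliesAlgebraicAV_of_forall_pmPow (hN : chartConjugation_canonical)
    (hex : ∀ ⦃n : ℕ⦄ ⦃X : SchemeOver ℂ⦄, IsSmoothProjective n X →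
      ∀ (σ : ℂ ≃+* ℂ) (p : ℕ) (c : complexBetti X (2 * p)), ∃ s, IsConjugateClass σ X (2 * p) c s)
    (hZf : deligne1982_cycleClass_absoluteHodge) (hL : deligne1982_lefschetz_absoluteHodge_iff)
    (hcup : deligne1982_cupProduct_absoluteHodge) (hgys : deligne1982_gysinFst_absoluteHodge)
    (h : ∀ ⦃C : SchemeOver ℂ⦄, IsSmoothProjective 1 C → ∀ 𝒥 : Jacobian C,
      AbsoluteHodgeClassesAreAlgebraicFor ((𝒥.J.dim + 1) * (1 + 1)) (pmPow C 𝒥.J.dim)) :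
    AbsoluteHodgeImpliesAlgebraicAV := by
  intro A p c hc
  obtain ⟨C, hC, 𝒥, φ, hφ⟩ := langeBirkenhake1992_exists_jacobian_surjective_hom_holds A
  haveI : Surjective φ.hom.hom.hom.left := hφ
  exact (absoluteHodgeClassesAreAlgebraicFor_of_surjective hN hex hZf hL hcup hgys
    (AbelianVariety.isSmoothProjective_holds (A := 𝒥.J)) AbelianVariety.isSmoothProjective_holds φ.hom.hom.hom
    (absoluteHodgeClassesAreAlgebraicFor_jacobian_of_pmPow hN hex hZf hL hcup hgys hC 𝒥 (h hC 𝒥))).2 p c hc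

/-- **Row b06 gives 11.2.18 at every `(C × C)^{g+1}`** (mod the six facts): `(C × C)^{g+1}` is dominated by the powers of
`C` (gen 75's `isDominatedByPowers_pmPow`), `C` by the powers of `J(C)` (`CorCM.Stage4.isDominatedByPowers_curve_jacobian`),
and row b06 gives 11.2.18 on every variety dominated by the powers of an abelian variety (gen 76's
`absoluteHodgeClassesAreAlgebraicFor_of_isDominatedByPowers_abelianVariety`). Row b06 is the displayed hypothesis `h`.
[cite: Arapura2006, §1 Lemma 1.1, Lemma 1.3 and §4 Lemma 4.2] [cite: CharlesSchnell2014Notes, §11.2.5 statement 11.2.18] -/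
theorem absoluteHodgeClassesAreAlgebraicFor_pmPow_of_absoluteHodgeImpliesAlgebraicAV (hN : chartConjugation_canonical)
    (hex : ∀ ⦃n : ℕ⦄ ⦃X : SchemeOver ℂ⦄, IsSmoothProjective n X →
      ∀ (σ : ℂ ≃+* ℂ) (p : ℕ) (c : complexBetti X (2 * p)), ∃ s, IsConjugateClass σ X (2 * p) c s)
    (hZf : deligne1982_cycleClass_absoluteHodge) (hL : deligne1982_lefschetz_absoluteHodge_iff)
    (hcup : deligne1982_cupProduct_absoluteHodge) (hgys : deligne1982_gysinFst_absoluteHodge)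
    (h : AbsoluteHodgeImpliesAlgebraicAV) (hC : IsSmoothProjective 1 C) (𝒥 : Jacobian C) :
    AbsoluteHodgeClassesAreAlgebraicFor ((𝒥.J.dim + 1) * (1 + 1)) (pmPow C 𝒥.J.dim) :=
  absoluteHodgeClassesAreAlgebraicFor_of_isDominatedByPowers_abelianVariety hN hex hZf hL hcup hgys h
    (isSmoothProjective_pmPow hC 𝒥.J.dim) 𝒥.J
    (isDominatedByPowers_trans AbelianVariety.isSmoothProjective_holds hC (isSmoothProjective_pmPow hC 𝒥.J.dim)
      (isDominatedByPowers_pmPow hC 𝒥.J.dim) (isDominatedByPowers_curve_jacobian hC 𝒥))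

/-- **ROW b06 ⟺ CHARLES–SCHNELL'S 11.2.18 AT THE SINGLE VARIETY `(C × C)^{g+1}` OF EVERY SMOOTH PROJECTIVE COMPLEX CURVE
`C`** (`g = dim J(C)`, dimension `2g + 2`), mod (N)+(E) + V-B3 + T1c + CS7 + CS8 — ONE exponent per curve in place of gen
76's «all powers `Cᵏ`» (`absoluteHodgeImpliesAlgebraicAV_iff_curvePow_of_facts`). Neither side is asserted.
[cite: CharlesSchnell2014Notes, §11.2.5 statement 11.2.18] [cite: Serre1958MorphismesUniversels, no. 2 Thm. 1]
[cite: LangeBirkenhake1992, Prop. 4.5.8] [cite: Arapura2006, §1 Lemma 1.3 and §4 Lemma 4.2] -/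
theorem absoluteHodgeImpliesAlgebraicAV_iff_forall_pmPow (hN : chartConjugation_canonical)
    (hex : ∀ ⦃n : ℕ⦄ ⦃X : SchemeOver ℂ⦄, IsSmoothProjective n X →
      ∀ (σ : ℂ ≃+* ℂ) (p : ℕ) (c : complexBetti X (2 * p)), ∃ s, IsConjugateClass σ X (2 * p) c s)
    (hZf : deligne1982_cycleClass_absoluteHodge) (hL : deligne1982_lefschetz_absoluteHodge_iff)
    (hcup : deligne1982_cupProduct_absoluteHodge) (hgys : deligne1982_gysinFst_absoluteHodge) :
    AbsoluteHodgeImpliesAlgebraicAV ↔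
      ∀ ⦃C : SchemeOver ℂ⦄, IsSmoothProjective 1 C → ∀ 𝒥 : Jacobian C,
        AbsoluteHodgeClassesAreAlgebraicFor ((𝒥.J.dim + 1) * (1 + 1)) (pmPow C 𝒥.J.dim) :=
  ⟨fun h _ hC 𝒥 ↦ absoluteHodgeClassesAreAlgebraicFor_pmPow_of_absoluteHodgeImpliesAlgebraicAV hN hex hZf hL hcup hgys h hC 𝒥,
    absoluteHodgeImpliesAlgebraicAV_of_forall_pmPow hN hex hZf hL hcup hgys⟩

/-- **The Hodge conjecture at `(C × C)^{g+1}` gives the Hodge conjecture at `J(C)`** — hypothesis-free (Serre's surjection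
and §3's `hodgeConjectureFor_of_surjective`). [cite: Serre1958MorphismesUniversels, no. 2 Thm. 1]
[cite: vanGeemen1994HodgeAV, §3.7 Lemma 3.7] -/
theorem hodgeConjectureFor_jacobian_of_pmPow (hC : IsSmoothProjective 1 C) (𝒥 : Jacobian C)
    (h : HodgeConjectureFor ((𝒥.J.dim + 1) * (1 + 1)) (pmPow C 𝒥.J.dim)) : HodgeConjectureFor 𝒥.J.dim 𝒥.J.X := by
  haveI : IsProper C.hom := IsSmoothProjective.isProper_holds hC
  haveI : GeometricallyIntegral C.hom := IsSmoothProjective.geometricallyIntegral_holds hC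
  obtain ⟨P⟩ := hC.nonempty_algPoints ℂ
  haveI : Surjective (pmSum (𝒥.abelJacobi P) 𝒥.J.dim).left :=
    (Jacobian.generates_abelJacobi 𝒥 P).surjective_pmSum_of_dim_le P.toUnitHom le_rfl
  exact hodgeConjectureFor_of_surjective (isSmoothProjective_pmPow hC 𝒥.J.dim) AbelianVariety.isSmoothProjective_holds
    (pmSum (𝒥.abelJacobi P) 𝒥.J.dim) h

/-- **HC at the `(C × C)^{g+1}` of every curve gives `HC_AV`** — hypothesis-free (quotients of Jacobians,
`langeBirkenhake1992_exists_jacobian_surjective_hom_holds`, and `hodgeConjectureFor_of_surjective` twice).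
[cite: LangeBirkenhake1992, Prop. 4.5.8] [cite: Milne1986JacobianVarieties, §10 Thm. 10.1 (p. 198)] -/
theorem hc_av_of_forall_pmPow
    (h : ∀ ⦃C : SchemeOver ℂ⦄, IsSmoothProjective 1 C → ∀ 𝒥 : Jacobian C,
      HodgeConjectureFor ((𝒥.J.dim + 1) * (1 + 1)) (pmPow C 𝒥.J.dim)) :
    HodgeAbelianVarieties := by
  intro A
  obtain ⟨C, hC, 𝒥, φ, hφ⟩ := langeBirkenhake1992_exists_jacobian_surjective_hom_holds A
  haveI : Surjective φ.hom.hom.hom.left := hφ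
  exact hodgeConjectureFor_of_surjective (AbelianVariety.isSmoothProjective_holds (A := 𝒥.J))
    AbelianVariety.isSmoothProjective_holds φ.hom.hom.hom (hodgeConjectureFor_jacobian_of_pmPow hC 𝒥 (h hC 𝒥))

/-- **`HC_AV` gives HC at every `(C × C)^{g+1}`** — hypothesis-free: `(C × C)^{g+1}` is dominated by the powers of `J(C)`
and the Stage-4 kernel theorem `hc_of_isDominatedByPowers_abelianVariety_holds` (Arapura Lemma 4.2, PROVED) applies.
`HC_AV` is the displayed hypothesis `hAV`. [cite: Arapura2006, §1 Lemma 1.3 and §4 Lemma 4.2] -/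
theorem hodgeConjectureFor_pmPow_of_hc_av (hAV : HodgeAbelianVarieties) (hC : IsSmoothProjective 1 C) (𝒥 : Jacobian C) :
    HodgeConjectureFor ((𝒥.J.dim + 1) * (1 + 1)) (pmPow C 𝒥.J.dim) :=
  (hc_of_isDominatedByPowers_abelianVariety_holds hAV 𝒥.J (isSmoothProjective_pmPow hC 𝒥.J.dim)
    (isDominatedByPowers_trans AbelianVariety.isSmoothProjective_holds hC (isSmoothProjective_pmPow hC 𝒥.J.dim)
      (isDominatedByPowers_pmPow hC 𝒥.J.dim) (isDominatedByPowers_curve_jacobian hC 𝒥))).1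

/-- **`HC_AV ⟺` THE HODGE CONJECTURE FOR THE SINGLE `(2g+2)`-FOLD `(C × C)^{g+1}` OF EVERY SMOOTH PROJECTIVE COMPLEX CURVE
`C`** (`g = dim J(C)`) — HYPOTHESIS-FREE; ONE exponent per curve in place of gen 75's «all powers `Cᴺ`»
(`hc_av_iff_curvePow`). Neither side is asserted. [cite: Serre1958MorphismesUniversels, no. 2 Thm. 1] [cite: LangeBirkenhake1992, Prop. 4.5.8]
[cite: Arapura2006, §1 Lemma 1.3 and §4 Lemma 4.2] [cite: vanGeemen1994HodgeAV, §3.7 Lemma 3.7] -/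
theorem hc_av_iff_forall_pmPow :
    HodgeAbelianVarieties ↔
      ∀ ⦃C : SchemeOver ℂ⦄, IsSmoothProjective 1 C → ∀ 𝒥 : Jacobian C,
        HodgeConjectureFor ((𝒥.J.dim + 1) * (1 + 1)) (pmPow C 𝒥.J.dim) :=
  ⟨fun hAV _ hC 𝒥 ↦ hodgeConjectureFor_pmPow_of_hc_av hAV hC 𝒥, hc_av_of_forall_pmPow⟩

/-- `¬`-form for the record: `HC_AV` FAILS iff some smooth projective curve `C` (with a Jacobian `𝒥`) has a
non-algebraic rational Hodge class on `(C × C)^{dim J + 1}` — hypothesis-free. [cite: Arapura2006, §1 Lemma 1.3 and §4 Lemma 4.2] -/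
theorem not_hc_av_iff_exists_pmPow :
    ¬ HodgeAbelianVarieties ↔
      ∃ (C : SchemeOver ℂ) (_ : IsSmoothProjective 1 C) (𝒥 : Jacobian C),
        ¬ HodgeConjectureFor ((𝒥.J.dim + 1) * (1 + 1)) (pmPow C 𝒥.J.dim) := by
  rw [hc_av_iff_forall_pmPow]
  push Not
  exact ⟨fun ⟨C, hC, 𝒥, h⟩ ↦ ⟨C, hC, 𝒥, h⟩, fun ⟨C, hC, 𝒥, h⟩ ↦ ⟨C, hC, 𝒥, h⟩⟩

end OneExponent

/-! ## §5 The same with the cell's cartesian powers: `(C × C)^{g+1} ≅ C^{2g+2}` -/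

section CartesianPowers

variable {n : ℕ} {X X' C : SchemeOver ℂ}

/-- **Re-bracketing: Serre's `(X × X)^{m+1}` (`Motives.pmPow X m`) is isomorphic to the cartesian power `X^{2m+2}`
(`Motives.SchemeOver.pow`)** — by the associators and the left unitor of the cartesian monoidal structure, induction on
`m` (`X × X ≅ (𝟙 × X) × X = X²`; `(X × X)^{m+2} = (X × X)^{m+1} × (X × X) ≅ X^{2m+2} × (X × X) ≅ (X^{2m+2} × X) × X`). Stated
as `Nonempty` (no data is introduced in this theorem file). [folklore] -/
theorem nonempty_iso_pmPow_pow (X : SchemeOver ℂ) : ∀ m : ℕ, Nonempty (pmPow X m ≅ X.pow (2 * m + 2))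
  | 0 => ⟨whiskerRightIso (λ_ X).symm X⟩
  | m + 1 => by
    obtain ⟨e⟩ := nonempty_iso_pmPow_pow X m
    exact ⟨(e ⊗ᵢ Iso.refl (X ⊗ X)) ≪≫ (α_ (X.pow (2 * m + 2)) X X).symm⟩

/-- **11.2.18 transports along isomorphisms of smooth projective varieties** (mod (N)+(E): absolute Hodge classes pull
back along `e⁻¹`, `absolutePullback_of_canonical`; algebraic classes and Hodge models transport along `e`, the tree's
`IsoTransport`). [cite: CharlesSchnell2014Notes, §11.2.2 (11.2.2) and §11.2.5 statement 11.2.18] [cite: GrothendieckTopology1969, §1] -/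
theorem absoluteHodgeClassesAreAlgebraicFor_of_iso (hN : chartConjugation_canonical)
    (hex : ∀ ⦃n : ℕ⦄ ⦃X : SchemeOver ℂ⦄, IsSmoothProjective n X →
      ∀ (σ : ℂ ≃+* ℂ) (p : ℕ) (c : complexBetti X (2 * p)), ∃ s, IsConjugateClass σ X (2 * p) c s)
    (hX' : IsSmoothProjective n X') (hX : IsSmoothProjective n X) (e : X' ≅ X)
    (h : AbsoluteHodgeClassesAreAlgebraicFor n X) : AbsoluteHodgeClassesAreAlgebraicFor n X' := by
  refine ⟨(nonempty_hodgeModel_iff_of_iso e).2 h.1, fun p c' hc' ↦ ?_⟩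
  have h2 := (mem_algebraicClasses_map_iff_of_iso e).2
    (h.2 p _ (absolutePullback_of_canonical hN hex hX hX' e.inv p c' hc'))
  rwa [e.complexBetti_map_hom_map_inv] at h2

/-- `11.2.18` at `(C × C)^{g+1}` ⟺ `11.2.18` at `C^{2g+2}` (mod (N)+(E)), for a smooth projective curve `C`.
[cite: CharlesSchnell2014Notes, §11.2.5 statement 11.2.18] -/
theorem absoluteHodgeClassesAreAlgebraicFor_pmPow_iff_pow (hN : chartConjugation_canonical)
    (hex : ∀ ⦃n : ℕ⦄ ⦃X : SchemeOver ℂ⦄, IsSmoothProjective n X →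
      ∀ (σ : ℂ ≃+* ℂ) (p : ℕ) (c : complexBetti X (2 * p)), ∃ s, IsConjugateClass σ X (2 * p) c s)
    (hC : IsSmoothProjective 1 C) (g : ℕ) :
    AbsoluteHodgeClassesAreAlgebraicFor ((g + 1) * (1 + 1)) (pmPow C g) ↔
      AbsoluteHodgeClassesAreAlgebraicFor (2 * g + 2) (C.pow (2 * g + 2)) := by
  obtain ⟨e⟩ := nonempty_iso_pmPow_pow C g
  have hP : IsSmoothProjective (2 * g + 2) (pmPow C g) := by
    have h := isSmoothProjective_pmPow hC g
    rwa [show (g + 1) * (1 + 1) = 2 * g + 2 by ring] at h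
  have hQ : IsSmoothProjective (2 * g + 2) (C.pow (2 * g + 2)) := by simpa using hC.pow (2 * g + 2)
  rw [show (g + 1) * (1 + 1) = 2 * g + 2 by ring]
  exact ⟨absoluteHodgeClassesAreAlgebraicFor_of_iso hN hex hQ hP e.symm, absoluteHodgeClassesAreAlgebraicFor_of_iso hN hex hP hQ e⟩

/-- **ROW b06 ⟺ 11.2.18 AT THE CARTESIAN POWER `C^{2g+2}` OF EVERY SMOOTH PROJECTIVE COMPLEX CURVE `C`** (`g = dim J(C)`),
mod the six facts — gen 76's «∀ k, 11.2.18(Cᵏ)» (`absoluteHodgeImpliesAlgebraicAV_iff_curvePow_of_facts`) cut down to the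
single exponent `k = 2g + 2`. Neither side is asserted. [cite: CharlesSchnell2014Notes, §11.2.5 statement 11.2.18]
[cite: Serre1958MorphismesUniversels, no. 2 Thm. 1] [cite: LangeBirkenhake1992, Prop. 4.5.8] -/
theorem absoluteHodgeImpliesAlgebraicAV_iff_forall_curvePow_two_mul_dim_add_two (hN : chartConjugation_canonical)
    (hex : ∀ ⦃n : ℕ⦄ ⦃X : SchemeOver ℂ⦄, IsSmoothProjective n X →
      ∀ (σ : ℂ ≃+* ℂ) (p : ℕ) (c : complexBetti X (2 * p)), ∃ s, IsConjugateClass σ X (2 * p) c s)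
    (hZf : deligne1982_cycleClass_absoluteHodge) (hL : deligne1982_lefschetz_absoluteHodge_iff)
    (hcup : deligne1982_cupProduct_absoluteHodge) (hgys : deligne1982_gysinFst_absoluteHodge) :
    AbsoluteHodgeImpliesAlgebraicAV ↔
      ∀ ⦃C : SchemeOver ℂ⦄, IsSmoothProjective 1 C → ∀ 𝒥 : Jacobian C,
        AbsoluteHodgeClassesAreAlgebraicFor (2 * 𝒥.J.dim + 2) (C.pow (2 * 𝒥.J.dim + 2)) := by
  rw [absoluteHodgeImpliesAlgebraicAV_iff_forall_pmPow hN hex hZf hL hcup hgys]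
  exact ⟨fun h C hC 𝒥 ↦ (absoluteHodgeClassesAreAlgebraicFor_pmPow_iff_pow hN hex hC _).1 (h hC 𝒥),
    fun h C hC 𝒥 ↦ (absoluteHodgeClassesAreAlgebraicFor_pmPow_iff_pow hN hex hC _).2 (h hC 𝒥)⟩

/-- The Hodge conjecture at `(C × C)^{g+1}` ⟺ at `C^{2g+2}` — hypothesis-free (the tree's `hodgeConjectureFor_iff_of_iso'`).
[cite: SerreGAGA1956, §2] -/
theorem hodgeConjectureFor_pmPow_iff_pow (C : SchemeOver ℂ) (g : ℕ) :
    HodgeConjectureFor ((g + 1) * (1 + 1)) (pmPow C g) ↔ HodgeConjectureFor (2 * g + 2) (C.pow (2 * g + 2)) := by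
  obtain ⟨e⟩ := nonempty_iso_pmPow_pow C g
  rw [show (g + 1) * (1 + 1) = 2 * g + 2 by ring]
  exact hodgeConjectureFor_iff_of_iso' e

/-- **`HC_AV ⟺` THE HODGE CONJECTURE FOR THE CARTESIAN POWER `C^{2g+2}` OF EVERY SMOOTH PROJECTIVE COMPLEX CURVE `C`**
(`g = dim J(C)`) — HYPOTHESIS-FREE; gen 75's «∀ N, HC(Cᴺ)» (`hc_av_iff_curvePow`) cut down to the single exponent
`N = 2g + 2`. Neither side is asserted. [cite: Serre1958MorphismesUniversels, no. 2 Thm. 1] [cite: LangeBirkenhake1992, Prop. 4.5.8]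
[cite: Arapura2006, §1 Lemma 1.3 and §4 Lemma 4.2] -/
theorem hc_av_iff_forall_curvePow_two_mul_dim_add_two :
    HodgeAbelianVarieties ↔
      ∀ ⦃C : SchemeOver ℂ⦄, IsSmoothProjective 1 C → ∀ 𝒥 : Jacobian C,
        HodgeConjectureFor (2 * 𝒥.J.dim + 2) (C.pow (2 * 𝒥.J.dim + 2)) := by
  rw [hc_av_iff_forall_pmPow]
  exact ⟨fun h C hC 𝒥 ↦ (hodgeConjectureFor_pmPow_iff_pow C _).1 (h hC 𝒥),
    fun h C hC 𝒥 ↦ (hodgeConjectureFor_pmPow_iff_pow C _).2 (h hC 𝒥)⟩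

end CartesianPowers

/-! ## Audit: nothing is decided here

Every theorem above is an implication out of displayed named facts of record ((N) `hN`, (E) `hex`, V-B3 `hZf`, T1c `hL`,
CS7 `hcup`, CS8 `hgys`) and displayed OPEN hypotheses, or hypothesis-free (`hc_av_iff_forall_pmPow` and its parts); row
b06 and `HC_AV` occur only inside `↔` / `¬ … ↔` or as the displayed hypotheses `h`, `hAV`; `HC_CM` does not occur. -/

end Summit.HodgeConjecture.HodgeConjecture.Ring2.Hypotheses

end
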